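import Summits.HodgeConjecture.CorCM.HypLiu418.A3Liu418GSInstance        -- ★ GS-4 p681495 (A-p01): `sec42DataGS`, `sec42HeckeTranslatesGS`, `etaleHeckeDatumGS`, `isogenyDescent_GS`
import Summits.HodgeConjecture.CorCM.HypLiu418.A3Liu418Items             -- ★ `CV` / `UV` (the face's uniform Weil model `muConj 𝕌_V`)
import Literature.NumberTheory.Automorphic.Liu2021.AppendixC.SeesawSource   -- ★ the clause's home: `EtaleHeckeDatum.omegaHom` (via `Thm415Pinned`), `IsArithFrobAt`, `SeesawSource.FrobeniusActsBy` :150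
import HarnessLib

/-!
# GS-6 — [Liu2021, App. D Thm. D.6 (1) + Rem. D.5, proof of Thm. 4.15 l. 2199–2212]: the arithmetic Frobenii act on the
# `ω(ν,ε,χ)|_{U(J⋆)}`-Hom-space of `ℚ_ℓ^{ac} ⊗ H¹_ét` of the GS unitary Shimura CURVE tower by `(ι′ μ^{alg}(ϖ_v))⁻¹` — NAMED FACT
# `frobeniusActsByGS` (Summits-resident by content, director hodgecm-mathlib 2026-08-29T00:05:40Z «(P-Sum)»; cell hodgecm-mathlib, E-GS)

ONE named fact `frobeniusActsByGS : Prop` (D-0014; no proof) — the clause BODY of ★ `SeesawSource.FrobeniusActsBy`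
(`Literature/NumberTheory/Automorphic/Liu2021/AppendixC/SeesawSource.lean` :150) token for token, unfolded at the GS curve's OWN §4.2
datum `sec42DataGS S h4 isoₛ` / `etaleHeckeDatumGS S hU7ₛ hLQ h4 isoₛ ℓ` (GS-4, `A3Liu418GSInstance`) for the face's uniform Weil model
`UV hDel F V a Φ` (★ `A3Liu418Items` :161, `= muConj (uniformOmegaRep …)`, whose `rho` is the Literature `rhoAtLine … 3 …` transported along
the face frame — `rfl`) restricted along `φGS` (`u ↦ R_B (u ⊕ 1)`, ★ GS-2 `UnitaryShimuraCurveRecord` :423); NEVER a `∀` over pinned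
`SeesawSource`s (that form is false).  The junction with file (b) `A3Liu418GSSeesawSource` (GS-8 core) is a HOME slot test, not part of
this file: at (b)'s explicit-carrier source `seesawSourceGS …` the GS-8 closer's clause (2) is
`(frobeniusActsBy_seesawSourceGS_iff …).2 (hGS6 …)` (equivalently `exact hGS6 …`).
Books: ONE unproved fan-B row (GENERIC in (R3)'s sense), registered with the 24832 registry v18 as `stub_GS6 : frobeniusActsByGS`
(director s93 (2), 00:05:40Z); a Literature twin (P-Lit-B′) is a post-v18 option (net 0).

## References

* [Liu2021] Y. Liu, *Fourier–Jacobi cycles and arithmetic relative trace formula* (FJcycle.tex), Thm. 4.15 proof p. 51 (l. 2199–2212);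
  App. D: Prop. D.4 (1) p. 130, Rem. D.5 p. 131, Thm. D.6 (1) p. 132, §D.4 Prop. D.8 p. 135, Cor. D.9 p. 138, proof pp. 139–140.
* [Carayol1986Compositio] H. Carayol, «Sur la mauvaise réduction des courbes de Shimura», Compositio Math. 59 (1986) 151–230,
  §10.3 p. 210, Prop. 10.3 p. 211; §4 p. 182, §6.7 p. 197, §7.2 p. 198, 9.4.1 p. 207.
* [Rajan2000] C. S. Rajan, PAMS 128 (2000) 691–700, Thm. 1.
* [LiuLorenzini1999] Q. Liu, D. Lorenzini, Compositio 118 (1999), Prop. 4.4 (a) p. 80.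
-/

noncomputable section

namespace Summit.HodgeConjecture.CorCM.Lines.A3Liu418

open scoped TensorProduct Matrix NumberField
open NumberField NumberField.InfinitePlace IsDedekindDomain
open Summit.HodgeConjecture.CorCM.Model
open Summit.HodgeConjecture.CorCM.Model.HComp Summit.HodgeConjecture.CorCM.HComp
open Literature.AlgebraicGeometry.Motives (CMType)
open Literature.AlgebraicGeometry.ShimuraVarieties.UnitaryCanonicalModel
open Literature.NumberTheory.Automorphic Literature.NumberTheory.Automorphic.UnitaryGroup
open Literature.NumberTheory.Automorphic.Liu2021 Literature.NumberTheory.Automorphic.Liu2021.AppendixC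
open Literature.NumberTheory.GaloisRepresentations
open Literature.AlgebraicGeometry.Liu2021 (IsAdmissibleElement)

set_option synthInstance.maxHeartbeats 400000 in
set_option maxHeartbeats 8000000 in
/-- **[Liu2021, proof of Thm. 4.15 l. 2199–2212 + Rem. D.5 + Thm. D.6 (1)] — NAMED FACT GS-6 `frobeniusActsByGS` (D-0014; NO proof;
Summits-resident by content, director 2026-08-29T00:05:40Z «(P-Sum)»): the arithmetic Frobenii act on the `ω(μ,ε,χ)|_{U(J⋆)}`-Hom-space
of `ℚ_ℓ^{ac} ⊗ H¹_ét` of the GS unitary Shimura CURVE tower by the scalar `(ι′ μ^{alg}(ϖ_v))⁻¹`, for almost all `v`.**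
PRINT. [Liu2021] App. D, `G = Res_{F/ℚ} U(V)` with `V` of RANK 2, signature `(1,1)` at `τ₁` and `(2,0)` elsewhere (l. 5355) — the
GS curve datum `U(J⋆)`; `ρ_{ι_ℓ}(π^∞) := Hom_{ℚ̄_ℓ[G(𝔸^∞)]}(ι_ℓ ∘ π^∞, H¹_ét(Sh(G,h)^‾, ℚ̄_ℓ))` (l. 5418–5426) is a CHARACTER of `Gal(ℂ/E)`
by Prop. D.4 (1) p. 130 («`Hom_{ℂ[G(𝔸^∞)]}(π^∞, H¹_B(Sh(G,h)^‾, ℂ))` has dimension 1»); **Thm. D.6 (1)** p. 132 (l. 5433–5443): «Suppose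
that `π^∞` is endoscopic cohomological, which is isomorphic to `ω(μ,ε,χ)` with `μ` of weight one and satisfying `τ′₁ ∈ Φ_μ` as in
Prop. D.4 (1). Then `ρ_ℓ(π^∞) = μ·|·|_E^{−1/2}` if `m_cusp(π_∞^{(1,0)} ⊗ π^∞) = 1`; `μ^c χ̌·|·|_E^{−1/2}` if `m_cusp(π_∞^{(0,1)} ⊗ π^∞) = 1`»;
the BRANCH by **Rem. D.5** p. 131 (l. 5396–5405): `m_cusp(π_∞^{(1,0)} ⊗ π^∞) = 1` iff `∃ e ∈ E^{×−}` with `ε_v = e·Nm_{E_v/F_v} E_v^×`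
for every finite `v`, `Im τ′_i(e) < 0` (`i ≥ 2`) and `Im τ′_1(e) < 0` — i.e. `ε` is `μ`-ADMISSIBLE (Def. 4.12 p. 47; the tree's
`IsAdmissibleElement`); proof of D.6 (1): §D.4 p. 134 ff., congruence relation **Prop. D.8** p. 135 ([Car86, Prop. 10.3; §§4, 6, 7, 9],
[LL99, Prop. 4.4 (a)], [DM69 §1], [Buz97], [DR73, KM85]) ⇒ **Cor. D.9** p. 138 ⇒ D.6 (1) pp. 139–140 ([BR93 §4], [Car12, Thm. 1.1],
[Raj00, Thm. 1]).  And the SEESAW sentence of the proof of Thm. 4.15, p. 51 l. 2199–2210 (PROVED in print, Fock-model computation): the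
theta functions of `ω(μ,ε)` restrict along `G⋆ ↪ G`, `u ↦ R_B(u ⊕ 1)`, to sums of theta functions `θ^{φ⋆,i}_μ` of `U(V⋆)` with the SAME
`μ`; l. 2212 «Then the theorem follows from the above claim, Remark D.5, and Theorem D.6 (1).»
TYPED (restricted shape (B), GS-PROGRAMME A.5/A.7/A.9; the clause BODY is ★ `SeesawSource.FrobeniusActsBy` (`AppendixC/SeesawSource`
:150) TOKEN FOR TOKEN, unfolded at the GS curve's OWN §4.2 datum — never a `∀` over pinned sources, which would be the FALSE form):
for every printed-citation witness `hDel`, CM field `F` (Galois over `ℚ`), hermitian face `(V, a, Φ)` of rank 3, conjugate-symplectic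
`ν` of weight one, prime `ℓ`, `ι′ : ℂ ≃ ℚ_ℓ^{ac}`, every GS curve RECORD `S : RecordSystemGS F J⋆ ι₁ K₀⋆` (★ GS-2) whose Hecke translates
are defined over `F` (u1 `hU7ₛ`) and whose level quotients are the printed ones (u4 `hLQ : S.IsLevelQuotient`; ★ GS-2b; isogeny
descent of its §4.2 datum `sec42DataGS S h4 isoₛ` is then GS-4's theorem `isogenyDescent_GS`), every adapted
frame `(J⊥, B, a′, hB)` with `ᵗ(c B)·(a′ H_V)·B = J⋆ ⊕ J⊥` and `0 < τ₁(a′)` real (`hτa`, `hτa′`: the complement `J⊥` is then a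
totally positive line at `τ₁` — print's honest sub-space `V = V⋆ ⊕ V⋆^⊥`, so Rem. D.5's `(1,0)` branch is the printed one; the frame
binders are exactly those of GS-2b `EmbeddingDefinedOver` / GS-8 core `towerHomGS`), every `ε` that is `ν`-ADMISSIBLE (`∃ e, IsAdmissibleElement F Φ_ν e ∧ epsOf e = ε`,
Rem. D.5's `(1,0)` branch) and every `χ`: there is a finite set of places outside which, for every arithmetic Frobenius `σ` at `v` and
every `f′ ∈ Hom_{ℚ̄_ℓ[U(J⋆)(𝔸_f)]}(ι′ ∘ (ω(ν,ε,χ) ∘ φGS), ℚ̄_ℓ ⊗ H¹_ét)` of the curve tower (`(etaleHeckeDatumGS …).omegaHom ι′ (((UV …).rho ν hν ε χ).comp φGS)`,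
`UV` = the face's uniform Weil model `muConj 𝕌_V`, ★ `A3Liu418Items` :161, whose `rho` IS the Literature `rhoAtLine … 3 …` transported along
the face frame `ιVE V` — `rfl`), `σ` acts on the values of `f′` by `(ι′ ((IdeleClassGroup.muAlg F ν).valueAtUniformizer v))⁻¹` (the tree's
normalisation: ARITHMETIC Frobenius, INVERSE uniformiser value, as ★ `S34SomeSource`).  Weaker-or-equal to print (only the `(1,0)` branch,
only the scalar on the Hom-space values, only almost all `v`; the restriction to `U(J⋆)` of the rank-3 `ω(ν,ε,χ)` decomposes in print into
`ω⋆`'s with the same `ν` and the same branch, l. 2199–2210).  DICTIONARY (ref2 Q1): the tree's `ν` with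
`hν : IsConjugateSymplectic` and CM type `hν.cmType` is print's label `μ` with `τ′₁ ∈ Φ_μ` (Prop. D.4 (1); for `n = 2` the two labels are
ambiguous, Lemma D.1 (4)), `UV = muConj 𝕌_V` relabelling `ν ↦ νᶜ` (★ `AdapterMuConj`, [Liu2021, Rem. 4.4]) — the SAME currency as ★
`S34AtFace` ∕ `S34SomeSource`, in which the junction consumes this fact; `(_hΦ : ι₁ ∈ Φ.1)` is carried as ★ `S34AtFace` carries it
(≤-print insurance; `(UV …).rho`, `.epsOf` enter only through `(V, a, Φ)`).  JUNK ANALYSIS: a record `S : RecordSystemGS F J⋆ ι₁ K₀⋆`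
cannot carry non-canonical models — its reciprocity law `S.recip` at the special points (★ GS-2 `UnitaryShimuraCurveRecord`, F3)
together with `S.pts` pins the CANONICAL model up to the u1-compatible isomorphism; the Galois side `towerRep` is the REAL `H¹_ét` of the
Albanese varieties (★ `AppendixC/EtaleH1Tower` §1–2) and the Hecke side is the one INDUCED by the record's translates
(★ `etaleHeckeDatumOfTranslates`); the ORIENTATION junk — an anti-oriented frame `ι₁ a′ < 0`, for which `negCone_{ι₁}(V⋆) = posCone_{ι₁}(J⋆)`,
the record is the complex-CONJUGATE datum of print's curve and print assigns the `(0,1)` branch `μᶜ χ̌` (Rem. D.5 via `e ↦ e/a′`; ref2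
2026-08-29 second reading) — is excluded by `hτa`/`hτa′` (E1).
[cite: Liu2021, Thm. D.6 (1) p. 132 (l. 5433–5443); Prop. D.4 (1) p. 130 (l. 5376–5383); Rem. D.5 p. 131 (l. 5396–5405); §D.3 set-up l. 5353–5359, l. 5408–5426; §D.4 Prop. D.8 p. 135, Cor. D.9 p. 138, proof of D.6 (1) pp. 139–140; Thm. 4.15 proof p. 51 (l. 2199–2212)]
[cite: Carayol1986Compositio, §10.3 p. 210; Prop. 10.3 p. 211; §§4, 6, 7, 9] [cite: Rajan2000, Thm. 1 p. 691] [cite: LiuLorenzini1999, Prop. 4.4 (a) p. 80] -/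
def frobeniusActsByGS : Prop :=
  ∀ (hDel : Literature.AlgebraicGeometry.ShimuraVarieties.UnitaryCanonicalModel.canonicalModel_exists_printed)
    (F : HodgeCM.CMField) [IsGalois ℚ F] {ι₁ : F →+* ℂ} (V : HodgeCM.HermSpace3 F ι₁) (a : HodgeCM.Model.LiuIndex.RealScalar F) (Φ : CMType F)
    (_hΦ : ι₁ ∈ Φ.1)
    (ν : Literature.NumberTheory.Automorphic.IdeleClassGroup (F : Type) →ₜ* Circle) (hν : IdeleClassGroup.IsConjugateSymplectic (F : Type) ν)
    (_hw : IdeleClassGroup.HasWeight (F : Type) ν 1)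
    (ℓ : ℕ) [Fact ℓ.Prime] (ι' : ℂ ≃+* AlgebraicClosure ℚ_[ℓ])
    -- the GS curve: record (★ GS-2), u1 Hecke translates over `F`, u4 level quotients (★ GS-2b), §4.2 tokens
    (Jstar : Matrix (Fin 2) (Fin 2) (F : Type))
    (K₀ : C5.OpenCompactSubgroup ↥(finAdelic ↥(maximalRealSubfield (F : Type)) (F : Type) (IsCMField.complexConj (F : Type)) 2 Jstar))
    (S : RecordSystemGS (F : Type) Jstar ι₁ K₀) (hU7ₛ : S.HeckeTranslateDefinedOver) (hLQ : S.IsLevelQuotient)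
    (h4 : 4 ≤ Module.finrank ℚ (F : Type)) (isoₛ : ℕ → Prop)
    -- the adapted frame `ᵗ(c B)·(a′ H_V)·B = J⋆ ⊕ J⊥`, `0 < τ₁(a′)`, along which `U(J⋆) ↪ U(V)`, `u ↦ R_B (u ⊕ 1)` (★ `φGS`)
    (Jperp : Matrix (Fin 1) (Fin 1) (F : Type)) (B : GL (Fin 3) (F : Type)) (a' : (F : Type)) (ha : a' ≠ 0)
    (hB : formCongr ((IsCMField.complexConj (F : Type) : (F : Type) ≃ₐ[↥(maximalRealSubfield (F : Type))] (F : Type)) :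
        (F : Type) →+* (F : Type)) B (a' • HodgeCM.HermSpace3.Hm V) = finSum 2 1 Jstar Jperp)
    (_hτa : 0 < (ι₁ a').re) (_hτa' : (ι₁ a').im = 0),
    ∀ (ε : (UV hDel F V a Φ).Eps),
      (∃ e : (F : Type), IsAdmissibleElement (F : Type) hν.cmType.1 e ∧ (UV hDel F V a Φ).epsOf e = ε) →
    ∀ (χ : (UV hDel F V a Φ).Chi),
      ∃ Sv : Set (HeightOneSpectrum (𝓞 (F : Type))), Sv.Finite ∧
        ∀ v ∉ Sv, ∀ 𝔓 ∈ v.primesAbove, ∀ σ : Field.absoluteGaloisGroup (F : Type), IsArithFrobAt (𝓞 (F : Type)) σ 𝔓 →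
          ∀ f' ∈ (etaleHeckeDatumGS (F := ⟨HodgeCM.CMField.K F⟩) S hU7ₛ hLQ h4 isoₛ ℓ).omegaHom ι'
              (((UV hDel F V a Φ).rho ν hν ε χ).comp
                (φGS (F : Type) Jstar Jperp (HodgeCM.HermSpace3.Hm V) B ha hB)),
          ∀ w, ((sec42DataGS (F := ⟨HodgeCM.CMField.K F⟩) S h4 isoₛ).towerRep ℓ σ).baseChange (AlgebraicClosure ℚ_[ℓ]) (f' w) =
            (ι' ((IdeleClassGroup.muAlg (F : Type) ν).valueAtUniformizer v))⁻¹ • f' w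

end Summit.HodgeConjecture.CorCM.Lines.A3Liu418

end
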